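import Summits.BirchSwinnertonDyer.BirchSwinnertonDyer.Theorems.ByReductionTypeAtTwoAdditiveConjATwoCongruenceNegDisc
import Summits.BirchSwinnertonDyer.BirchSwinnertonDyer.Theorems.ByReductionTypeAtTwoFineSelmerConjAAtTwoAdditivePotGoodCubicRealization
import Summits.BirchSwinnertonDyer.BirchSwinnertonDyer.Theorems.AlignedTransportAtTwoMainConjectureOfRankZeroBSDAtTwoFineRoadDivisionCubic
import Literature.NumberTheory.EllipticCurves.ModTwoReducibleIffTwoTorsionRoot
import Literature.NumberTheory.EllipticCurves.GlobalMinimalModel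
import Mathlib.Algebra.Polynomial.SpecificDegree
import HarnessLib

/-!
# C4″ `AdditivePotMultOverKAtTwo` (item stmt-BirchSwinnertonDyer-22618), the «irreducible Kato 12.10» input: statement (A) at `2` is
# TRANSPORTED between any `W/ℚ` with integer `b₂, b₄, b₆` and `Δ < 0` and its CUBIC MODEL `W′ = ⟨0, b₂, 0, 8b₄, 16b₆⟩`
# (the model-change brick under the general-model cubic-field door; KERNEL, theorems only)

Cell `bsd-2adic`, seat `bsd-2adic-k4-w3` GEN 9 (explicit unit (309)(7); `--supports 22618`). HONEST FRAMING (D-0036/D-0054): THEOREMS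
ONLY — no definition, no named fact, no `sorry`; closes nothing at the `∀`-level; nothing booked; BSD is not proved by any of this.

WHY. v11's research binder (I1M′) `hAnaMI` (statement (A) at `(W, 2)` on the irreducible non-abelian pot-mult curves of C4″) quantifies
over GLOBALLY MINIMAL models, while the K4 cone's kernel (A)₂ doors from `μ₂` of the cubic `2`-torsion field (cruxlead-19573-w2 GEN 7,
`TotallyComplexMu.conjA_two_cubicModel_of_classicalMu_of_discr_neg`, p728213) are stated for cubic models `y² = x³ + px² + qx + r`. This
file is the model change, with NO new field theory: for `W` with integer `b₂, b₄, b₆` the cubic model `W′ = ⟨0, b₂, 0, 8b₄, 16b₆⟩`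
(`y ↦ (y − a₁x − a₃)/2`, then `(x, y) ↦ (x/4, y/8)`) satisfies `Δ(W′) = 2¹²·Δ(W)`, `16·disc(X³ + b₂X² + 8b₄X + 16b₆) = 2¹²·Δ(W)`, its
`2`-division cubic is `4·(X³ + b₂X² + 8b₄X + 16b₆)` whose roots are `4·` the roots of `4x³ + b₂x² + 2b₄x + b₆` (Mathlib
`twoTorsionPolynomial`), so the two `2`-division cubics have the SAME splitting field in `ℚ̄`, `W[2] ≅ W′[2]` `Γ_ℚ`-equivariantly (att-p5
`DivisionCubic.exists_torsionIso_two_of_adjoin_rootSet_eq`), and for `Δ < 0` statement (A) at `2` is an invariant of `E[2]` (addL2x GEN 12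
`conjA_two_iff_of_torsionIso_of_Δ_neg` = Lim–Sujatha Prop. 3.2 at `(ℚ, 2)`).

* §1 `aeval_cubicModel_four_mul` (`g(4x) = 16·f(x)`), `sixteen_mul_cubicModel_discr_eq` (`16·disc g = 2¹²·Δ(W)`),
  `cubicModel_discr_neg_of_Δ_neg`, `isElliptic_cubicModel_of_Δ_neg`, `irreducible_cubicModel_of_hasIrreducibleModPGaloisRep_two`
  (no rational root of `g` ⟸ none of `f` ⟸ `W[2]` irreducible, `ModTwoReducibleIffTwoTorsionRoot`),
  `adjoin_rootSet_twoTorsionPolynomial_eq_cubicModel` (same splitting field), `adjoin_four_mul_eq` (`ℚ(4β) = ℚ(β)`).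
* §2 **`conjA_two_iff_cubicModel_of_Δ_neg`** — (A)₂(W) ⟺ (A)₂(W′) (`∃ γ D` kernel form, every cyclotomic `κ`), `Δ(W) < 0`.
* §3 `b₂_eq_integralModelInt` & co. — a globally minimal `W` has integer `b₂, b₄, b₆` (Mathlib `map_b₂`, tree `map_integralModelInt`).

References: [LimSujatha2018] §3 Prop. 3.2; [CoatesSujatha2005] Conj. A, Thm. 3.4; [SilvermanAEC2009] III.§1 (`bᵢ`, `Δ = 16·disc`,
change of variables), III.2.3, VIII.§1, VIII.§8; tree `…ConjATwoCongruenceNegDisc` (addL2x GEN 12), `…FineRoadDivisionCubic` (att-p5),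
`…PotGoodCubicRealization` (k4-w1), `ModTwoReducibleIffTwoTorsionRoot`, `GlobalMinimalModel`.
-/

set_option autoImplicit false
-- the Theorems namespace of this sub repeats the summit name by design (D-0017 nested layout)
set_option linter.dupNamespace false

noncomputable section

open scoped Classical NumberField Polynomial IntermediateField
open NumberField Field Polynomial IntermediateField

namespace Summit.BirchSwinnertonDyer.BirchSwinnertonDyer.Theorems.AddKatoTwo

open WeierstrassCurve Literature.NumberTheory.EllipticCurves Literature.NumberTheory.EllipticCurves.ZpExtension
  Literature.NumberTheory.GaloisRepresentations Literature.NumberTheory.IwasawaTheory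
  Summit.BirchSwinnertonDyer.BirchSwinnertonDyer.Theorems.AlignedTransportAtTwoFineRoad

variable (W : WeierstrassCurve ℚ) [W.IsElliptic]

/-! ## §1 The cubic model `⟨0, b₂, 0, 8b₄, 16b₆⟩`: polynomial, discriminant, irreducibility, splitting field -/

omit [W.IsElliptic] in
/-- The `2`-division cubic `f = 4x³ + b₂x² + 2b₄x + b₆` of `W` and the monic integer cubic `g = X³ + b₂X² + 8b₄X + 16b₆` of the cubic model:
`g(4x) = 16·f(x)` in any `ℚ`-algebra. [cite: SilvermanAEC2009, III.§1 and III.2.3] -/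
theorem aeval_cubicModel_four_mul {B₂ B₄ B₆ : ℤ} (h₂ : W.b₂ = B₂) (h₄ : W.b₄ = B₄) (h₆ : W.b₆ = B₆)
    {A : Type} [CommRing A] [Algebra ℚ A] (x : A) :
    aeval (algebraMap ℚ A 4 * x) (Cubic.toPoly ⟨1, ((B₂ : ℤ) : ℚ), ((8 * B₄ : ℤ) : ℚ), ((16 * B₆ : ℤ) : ℚ)⟩) =
      algebraMap ℚ A 16 * aeval x W.twoTorsionPolynomial.toPoly := by
  simp only [Cubic.toPoly, WeierstrassCurve.twoTorsionPolynomial, h₂, h₄, h₆, map_one, one_mul, map_add, map_mul, map_pow,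
    aeval_X, map_intCast, map_ofNat, Int.cast_mul, Int.cast_ofNat]
  ring

omit [W.IsElliptic] in
/-- `16·disc(X³ + b₂X² + 8b₄X + 16b₆) = 2¹²·Δ(W)` (Mathlib's `b`-relation `4b₈ = b₂b₆ − b₄²`). [cite: SilvermanAEC2009, III.§1] -/
theorem sixteen_mul_cubicModel_discr_eq {B₂ B₄ B₆ : ℤ} (h₂ : W.b₂ = B₂) (h₄ : W.b₄ = B₄) (h₆ : W.b₆ = B₆) :
    (16 : ℚ) * Cubic.discr ⟨1, ((B₂ : ℤ) : ℚ), ((8 * B₄ : ℤ) : ℚ), ((16 * B₆ : ℤ) : ℚ)⟩ = 4096 * W.Δ := by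
  have hb8 : 4 * W.b₈ = W.b₂ * W.b₆ - W.b₄ ^ 2 := W.b_relation
  have hΔW : (4096 : ℚ) * W.Δ = -1024 * (B₂ : ℚ) ^ 3 * B₆ + 1024 * (B₂ : ℚ) ^ 2 * B₄ ^ 2 - 32768 * (B₄ : ℚ) ^ 3
      - 110592 * (B₆ : ℚ) ^ 2 + 36864 * (B₂ : ℚ) * B₄ * B₆ := by
    have e : W.Δ = -W.b₂ ^ 2 * W.b₈ - 8 * W.b₄ ^ 3 - 27 * W.b₆ ^ 2 + 9 * W.b₂ * W.b₄ * W.b₆ := rfl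
    rw [e, ← h₂, ← h₄, ← h₆]
    linear_combination (-1024 * W.b₂ ^ 2) * hb8
  rw [hΔW]; simp only [Cubic.discr]; push_cast; ring

omit [W.IsElliptic] in
/-- `Δ(W) < 0` ⟹ `disc(X³ + b₂X² + 8b₄X + 16b₆) < 0`. [cite: SilvermanAEC2009, III.§1] -/
theorem cubicModel_discr_neg_of_Δ_neg {B₂ B₄ B₆ : ℤ} (h₂ : W.b₂ = B₂) (h₄ : W.b₄ = B₄) (h₆ : W.b₆ = B₆) (hΔ : W.Δ < 0) :
    Cubic.discr ⟨1, ((B₂ : ℤ) : ℚ), ((8 * B₄ : ℤ) : ℚ), ((16 * B₆ : ℤ) : ℚ)⟩ < 0 := by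
  have e := sixteen_mul_cubicModel_discr_eq W h₂ h₄ h₆
  linarith

/-- The cubic model `⟨0, b₂, 0, 8b₄, 16b₆⟩` of an elliptic `W` (integer `bᵢ`) is an elliptic curve (`Δ(W′) = 2¹²Δ(W) ≠ 0`).
[cite: SilvermanAEC2009, III.§1] -/
theorem isElliptic_cubicModel_of_b {B₂ B₄ B₆ : ℤ} (h₂ : W.b₂ = B₂) (h₄ : W.b₄ = B₄) (h₆ : W.b₆ = B₆) :
    ((⟨0, ((B₂ : ℤ) : ℚ), 0, ((8 * B₄ : ℤ) : ℚ), ((16 * B₆ : ℤ) : ℚ)⟩ : WeierstrassCurve ℚ)).IsElliptic := by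
  refine isElliptic_cubicModel _ _ _ fun h0 ↦ ?_
  have e := sixteen_mul_cubicModel_discr_eq W h₂ h₄ h₆
  rw [h0, mul_zero] at e
  exact W.isUnit_Δ.ne_zero (by linarith)

/-- `W[2]` irreducible ⟹ the monic cubic `X³ + b₂X² + 8b₄X + 16b₆` is irreducible over `ℚ` (a rational root `y` would give the rational
root `y/4` of the `2`-division cubic, i.e. a rational point of order `2`). [cite: SilvermanAEC2009, III.2.3 and VIII.§1] -/
theorem irreducible_cubicModel_of_hasIrreducibleModPGaloisRep_two {B₂ B₄ B₆ : ℤ} (h₂ : W.b₂ = B₂) (h₄ : W.b₄ = B₄)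
    (h₆ : W.b₆ = B₆) (hirr : W.HasIrreducibleModPGaloisRep 2) :
    Irreducible (Cubic.toPoly ⟨1, ((B₂ : ℤ) : ℚ), ((8 * B₄ : ℤ) : ℚ), ((16 * B₆ : ℤ) : ℚ)⟩) := by
  haveI : Fact (Nat.Prime 2) := ⟨Nat.prime_two⟩
  refine Polynomial.irreducible_of_degree_le_three_of_not_isRoot ?_ fun y hy ↦ ?_
  · rw [Cubic.natDegree_of_a_ne_zero (by change (1 : ℚ) ≠ 0; norm_num)]; decide
  · have hroot : W.twoTorsionPolynomial.toPoly.IsRoot (y / 4) := by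
      have h16 := aeval_cubicModel_four_mul W h₂ h₄ h₆ (A := ℚ) (y / 4)
      rw [Polynomial.IsRoot.def, ← Polynomial.coe_aeval_eq_eval] at hy ⊢
      have e4 : algebraMap ℚ ℚ 4 * (y / 4) = y := by rw [Algebra.algebraMap_self, RingHom.id_apply]; ring
      rw [e4, hy] at h16
      have h16' : (algebraMap ℚ ℚ 16) ≠ 0 := by rw [Algebra.algebraMap_self, RingHom.id_apply]; norm_num
      exact (mul_eq_zero.mp h16.symm).resolve_left h16'
    exact (W.not_hasIrreducibleModPGaloisRep_two_iff_exists_isRoot_twoTorsionPolynomial.mpr ⟨_, hroot⟩) hirr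

omit [W.IsElliptic] in
/-- The `2`-division cubic of the cubic model `⟨0, b₂, 0, 8b₄, 16b₆⟩` is `4·(X³ + b₂X² + 8b₄X + 16b₆)`. [cite: SilvermanAEC2009, III.§1] -/
theorem twoTorsionPolynomial_cubicModel_eq (B₂ B₄ B₆ : ℤ) :
    ((⟨0, ((B₂ : ℤ) : ℚ), 0, ((8 * B₄ : ℤ) : ℚ), ((16 * B₆ : ℤ) : ℚ)⟩ : WeierstrassCurve ℚ)).twoTorsionPolynomial.toPoly =
      C (4 : ℚ) * Cubic.toPoly ⟨1, ((B₂ : ℤ) : ℚ), ((8 * B₄ : ℤ) : ℚ), ((16 * B₆ : ℤ) : ℚ)⟩ := by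
  simp only [WeierstrassCurve.twoTorsionPolynomial, Cubic.toPoly, WeierstrassCurve.b₂, WeierstrassCurve.b₄,
    WeierstrassCurve.b₆, C_add, C_mul, C_pow, map_ofNat, C_0, map_one, one_mul]
  ring

omit [W.IsElliptic] in
/-- Root set of the cubic model's `2`-division cubic = zero set of `X³ + b₂X² + 8b₄X + 16b₆` in `ℚ̄`. [cite: SilvermanAEC2009, III.§1] -/
theorem mem_rootSet_twoTorsionPolynomial_cubicModel_iff (B₂ B₄ B₆ : ℤ) (y : AlgebraicClosure ℚ) :
    y ∈ ((⟨0, ((B₂ : ℤ) : ℚ), 0, ((8 * B₄ : ℤ) : ℚ), ((16 * B₆ : ℤ) : ℚ)⟩ : WeierstrassCurve ℚ)).twoTorsionPolynomial.toPoly.rootSet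
        (AlgebraicClosure ℚ) ↔
      aeval y (Cubic.toPoly ⟨1, ((B₂ : ℤ) : ℚ), ((8 * B₄ : ℤ) : ℚ), ((16 * B₆ : ℤ) : ℚ)⟩) = 0 := by
  have hW'0 : ((⟨0, ((B₂ : ℤ) : ℚ), 0, ((8 * B₄ : ℤ) : ℚ), ((16 * B₆ : ℤ) : ℚ)⟩ : WeierstrassCurve ℚ)).twoTorsionPolynomial.toPoly ≠ 0 :=
    Cubic.ne_zero_of_a_ne_zero (by change (4 : ℚ) ≠ 0; norm_num)
  have h4 : (algebraMap ℚ (AlgebraicClosure ℚ) 4) ≠ 0 := by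
    rw [map_ne_zero_iff _ (algebraMap ℚ (AlgebraicClosure ℚ)).injective]; norm_num
  have hpoly := twoTorsionPolynomial_cubicModel_eq B₂ B₄ B₆
  rw [mem_rootSet, hpoly, map_mul, aeval_C]
  exact ⟨fun h ↦ (mul_eq_zero.mp h.2).resolve_left h4, fun h ↦ ⟨by rw [← hpoly]; exact hW'0, by rw [h, mul_zero]⟩⟩

omit [W.IsElliptic] in
/-- **Same splitting field.** The `2`-division cubics of `W` (integer `bᵢ`) and of its cubic model `⟨0, b₂, 0, 8b₄, 16b₆⟩` generate the same
subfield of `ℚ̄` (their root sets differ by the factor `4`). [cite: SilvermanAEC2009, III.§1 and VIII.§1] -/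
theorem adjoin_rootSet_twoTorsionPolynomial_eq_cubicModel {B₂ B₄ B₆ : ℤ} (h₂ : W.b₂ = B₂) (h₄ : W.b₄ = B₄) (h₆ : W.b₆ = B₆) :
    IntermediateField.adjoin ℚ (W.twoTorsionPolynomial.toPoly.rootSet (AlgebraicClosure ℚ)) =
      IntermediateField.adjoin ℚ (((⟨0, ((B₂ : ℤ) : ℚ), 0, ((8 * B₄ : ℤ) : ℚ), ((16 * B₆ : ℤ) : ℚ)⟩ : WeierstrassCurve ℚ)).twoTorsionPolynomial.toPoly.rootSet
        (AlgebraicClosure ℚ)) := by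
  have hf0 : W.twoTorsionPolynomial.toPoly ≠ 0 := Cubic.ne_zero_of_a_ne_zero (by change (4 : ℚ) ≠ 0; norm_num)
  have h16 : (algebraMap ℚ (AlgebraicClosure ℚ) 16) ≠ 0 := by
    rw [map_ne_zero_iff _ (algebraMap ℚ (AlgebraicClosure ℚ)).injective]; norm_num
  have hyg := mem_rootSet_twoTorsionPolynomial_cubicModel_iff B₂ B₄ B₆
  apply le_antisymm
  · rw [IntermediateField.adjoin_le_iff]
    intro x hx
    have hx' := (mem_rootSet.mp hx).2
    have hy : algebraMap ℚ (AlgebraicClosure ℚ) 4 * x ∈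
        ((⟨0, ((B₂ : ℤ) : ℚ), 0, ((8 * B₄ : ℤ) : ℚ), ((16 * B₆ : ℤ) : ℚ)⟩ : WeierstrassCurve ℚ)).twoTorsionPolynomial.toPoly.rootSet
          (AlgebraicClosure ℚ) := by
      rw [hyg, aeval_cubicModel_four_mul W h₂ h₄ h₆, hx', mul_zero]
    have e : x = algebraMap ℚ (AlgebraicClosure ℚ) (1 / 4 : ℚ) * (algebraMap ℚ (AlgebraicClosure ℚ) 4 * x) := by
      rw [← mul_assoc, ← map_mul]; norm_num
    rw [SetLike.mem_coe, e]
    exact mul_mem (IntermediateField.algebraMap_mem _ _) (IntermediateField.subset_adjoin ℚ _ hy)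
  · rw [IntermediateField.adjoin_le_iff]
    intro y hy
    have hy' := (hyg y).mp hy
    set x : AlgebraicClosure ℚ := algebraMap ℚ (AlgebraicClosure ℚ) (1 / 4 : ℚ) * y with hxdef
    have exy : algebraMap ℚ (AlgebraicClosure ℚ) 4 * x = y := by
      rw [hxdef, ← mul_assoc, ← map_mul]; norm_num
    have hx : x ∈ W.twoTorsionPolynomial.toPoly.rootSet (AlgebraicClosure ℚ) := by
      rw [mem_rootSet]
      refine ⟨hf0, ?_⟩
      have h := aeval_cubicModel_four_mul W h₂ h₄ h₆ x
      rw [exy, hy'] at h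
      exact (mul_eq_zero.mp h.symm).resolve_left h16
    rw [SetLike.mem_coe, ← exy]
    exact mul_mem (IntermediateField.algebraMap_mem _ _) (IntermediateField.subset_adjoin ℚ _ hx)

/-- `ℚ(4β) = ℚ(β)` inside `ℚ̄`. [folklore] -/
theorem adjoin_four_mul_eq (β : AlgebraicClosure ℚ) :
    IntermediateField.adjoin ℚ ({algebraMap ℚ (AlgebraicClosure ℚ) 4 * β} : Set (AlgebraicClosure ℚ)) =
      IntermediateField.adjoin ℚ ({β} : Set (AlgebraicClosure ℚ)) := by
  apply le_antisymm
  · rw [IntermediateField.adjoin_simple_le_iff]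
    exact mul_mem (IntermediateField.algebraMap_mem _ _) (IntermediateField.mem_adjoin_simple_self ℚ β)
  · rw [IntermediateField.adjoin_simple_le_iff]
    convert mul_mem (IntermediateField.algebraMap_mem _ (1 / 4 : ℚ))
      (IntermediateField.mem_adjoin_simple_self ℚ (algebraMap ℚ (AlgebraicClosure ℚ) 4 * β)) using 1
    rw [← mul_assoc, ← map_mul]; norm_num

/-! ## §2 (A)₂ is transported between `W` and its cubic model (`Δ < 0`) -/

/-- **(A)₂(W) ⟺ (A)₂(W′) for the cubic model `W′ = ⟨0, b₂, 0, 8b₄, 16b₆⟩ of a `W` with integer `bᵢ` and `Δ(W) < 0`** (`∃ γ D` kernel form,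
every cyclotomic `κ`): same splitting field of the `2`-division cubics ⟹ `W[2] ≅ W′[2]` equivariantly
(`DivisionCubic.exists_torsionIso_two_of_adjoin_rootSet_eq`) ⟹ Lim–Sujatha Prop. 3.2 at `(ℚ, 2)` on `Δ < 0`
(`conjA_two_iff_of_torsionIso_of_Δ_neg`), with `Δ(W′) = 2¹²Δ(W) < 0`. [cite: LimSujatha2018, §3 Prop. 3.2]
[cite: CoatesSujatha2005, Conj. A and Thm. 3.4] [cite: SilvermanAEC2009, III.§1 and VIII.§1] -/
theorem conjA_two_iff_cubicModel_of_Δ_neg {B₂ B₄ B₆ : ℤ} (h₂ : W.b₂ = B₂) (h₄ : W.b₄ = B₄) (h₆ : W.b₆ = B₆) (hΔ : W.Δ < 0)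
    [((⟨0, ((B₂ : ℤ) : ℚ), 0, ((8 * B₄ : ℤ) : ℚ), ((16 * B₆ : ℤ) : ℚ)⟩ : WeierstrassCurve ℚ)).IsElliptic]
    (κ : ZpExtension ℚ 2) (hκ : κ.IsCyclotomic) :
    (∃ (γ : absoluteGaloisGroup ℚ) (D : W.FineSelmerDualData κ γ),
        Module.Finite ℤ_[2] (RestrictScalars ℤ_[2] (IwasawaAlgebra 2) D.X)) ↔
      ∃ (γ : absoluteGaloisGroup ℚ)
        (D : ((⟨0, ((B₂ : ℤ) : ℚ), 0, ((8 * B₄ : ℤ) : ℚ), ((16 * B₆ : ℤ) : ℚ)⟩ : WeierstrassCurve ℚ)).FineSelmerDualData κ γ),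
        Module.Finite ℤ_[2] (RestrictScalars ℤ_[2] (IwasawaAlgebra 2) D.X) := by
  have hΔ' : ((⟨0, ((B₂ : ℤ) : ℚ), 0, ((8 * B₄ : ℤ) : ℚ), ((16 * B₆ : ℤ) : ℚ)⟩ : WeierstrassCurve ℚ)).Δ < 0 := by
    rw [cubicModel_Δ]
    have e := sixteen_mul_cubicModel_discr_eq W h₂ h₄ h₆
    linarith
  obtain ⟨e, he⟩ := DivisionCubic.exists_torsionIso_two_of_adjoin_rootSet_eq W
    (⟨0, ((B₂ : ℤ) : ℚ), 0, ((8 * B₄ : ℤ) : ℚ), ((16 * B₆ : ℤ) : ℚ)⟩ : WeierstrassCurve ℚ)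
    (adjoin_rootSet_twoTorsionPolynomial_eq_cubicModel W h₂ h₄ h₆)
  exact conjA_two_iff_of_torsionIso_of_Δ_neg W _ hΔ hΔ' e he κ hκ

/-! ## §3 A globally minimal `W` has integer `b₂, b₄, b₆` -/

section IntegralB

variable [W.IsGloballyMinimal]

omit [W.IsElliptic] in
/-- `b₂(W) = b₂` of the integral model over `ℤ`, for a globally minimal `W`. [cite: SilvermanAEC2009, VIII.§8 and III.§1] -/
theorem b₂_eq_integralModelInt : W.b₂ = ((integralModelInt W).b₂ : ℚ) := by
  have h := congrArg WeierstrassCurve.b₂ (map_integralModelInt W)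
  rw [WeierstrassCurve.map_b₂, eq_intCast] at h
  exact h.symm

omit [W.IsElliptic] in
/-- `b₄(W) = b₄` of the integral model over `ℤ`, for a globally minimal `W`. [cite: SilvermanAEC2009, VIII.§8 and III.§1] -/
theorem b₄_eq_integralModelInt : W.b₄ = ((integralModelInt W).b₄ : ℚ) := by
  have h := congrArg WeierstrassCurve.b₄ (map_integralModelInt W)
  rw [WeierstrassCurve.map_b₄, eq_intCast] at h
  exact h.symm

omit [W.IsElliptic] in
/-- `b₆(W) = b₆` of the integral model over `ℤ`, for a globally minimal `W`. [cite: SilvermanAEC2009, VIII.§8 and III.§1] -/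
theorem b₆_eq_integralModelInt : W.b₆ = ((integralModelInt W).b₆ : ℚ) := by
  have h := congrArg WeierstrassCurve.b₆ (map_integralModelInt W)
  rw [WeierstrassCurve.map_b₆, eq_intCast] at h
  exact h.symm

end IntegralB

end Summit.BirchSwinnertonDyer.BirchSwinnertonDyer.Theorems.AddKatoTwo

end
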